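import Mathlib
import HarnessLib
import HarnessLib.Audit
import Summits.MatrixMultiplication.Statement
import Literature.Computability.AlgebraicComplexity.RectangularExponentAlpha

/-!
Route: OctaveBudget

DORMANT since 2026-09-04T15:42:28Z (reconciler: no traction for 5 d (last activity statement-checked at 2026-08-30T14:26:42Z); parked, not closed — `ledger route dormant route-MatrixMultiplication-OctaveBudget --off` to reactivate) — unstaffed, not closed; items shared with open routes are served there. `ledger route dormant <id> --off` reactivates.

# Route OctaveBudget — omega=2 iff the long-shape excess decays linearly, halving costs less than a
factor two down to the 1x2 rectangle, and the square is root-linked to it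

It suffices to show X = LinearExcessDecay ∧ TailSubcriticalDoubling ∧ SquareLink (and S ⟺ X, kernel
`summit_iff_split3` in the lens draft OctaveBudget_v3.lean; gen 3 = N5″ of the decomp-mm cell, lens
5: finite range + asymptotic regime + bridge).
Axis: the long-shape excess e(k) := ω(1,k,1) − (k+1) ≥ 0 of ⟨n, n^k, n⟩ (e(1) = ω − 2; e
non-increasing, convex; e → 0 PROVED, Coppersmith 1982 / Lotti–Romani 1983 Prop 4.1).
RATE piece LinearExcessDecay = ∃ C ∀ integer k ≥ 1, e(k) ≤ C/k (amortisation at a linear rate;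
strictly BELOW FiniteSaturation and the δ = 1 member of lens 2's PowerAmortisation; finite-range
rungs LinearDecayUpTo 2 K: K ≤ 5 kernel, K ≤ 10 modulo the printed VXXZ-2024 row κ = 3, K = 12/16
from ONE beyond-print κ-bound, K = ∞ the bet).
TAIL-BRIDGE piece TailSubcriticalDoubling = ∃ C' < 2 ∀ integer k ≥ 2, e(k) ≤ C'·e(2k)
(un-amortisation ⟨n,n,n^{2k}⟩ ↦ ⟨n,n,n^k⟩ costs less than a factor two of excess per octave, DOWN TO
THE 1×2 RECTANGLE ONLY). RATE ∧ TAIL-BRIDGE ⟺ TwoSaturation := ω(1,2,1) = 3 exactly (kernel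
`twoSaturation_iff_led_and_tsd`: budget from octave 1, e(2) ≤ C'^{j−1} e(2^j) ≤ (C/2)(C'/2)^{j−1} →
0) — the i = 1 member of the exact UN-AMORTISATION LADDER ω(1,2^i,1) = 2^i+1 ⟺ RATE ∧ TailCap_{≥i}
(`dyadicSaturation_iff`; i = 0 is gen 2's node LinearExcessDecay ∧ SubcriticalDoubling, now an
aside).
LINK piece SquareLink = (ω − 2)² ≤ ω(1,2,1) − 3 (lens 2's item stmt-23740, shared: a square-root
modulus of continuity of the excess at the square closes the last octave 2 → 1 WITHOUT un-amortising
it). S ⟺ TwoSaturation ∧ SquareLink (`summit_iff_twoSaturation_and_squareLink`), so E₂ =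
TwoSaturation is an OR-node of the cell's tree (lens 2 reaches it from FiniteSaturation ∧
ExcessLogConvexity, this route from RATE ∧ TAIL-CAP). Residual weakened from gen 2:
SubcriticalDoubling ⟺ TailSubcriticalDoubling ∧ StrictSquareCap and StrictSquareCap ⟹ SquareLink
(kernel, via ω − 2 ≤ 0.37295 < 1/2), not conversely. No idea card realised.
Lean: `(∃ C : ℝ, ∀ k : ℕ, 1 ≤ k → Literature.Computability.AlgebraicComplexity.omegaRect ℂ 1 k 1 -
(k + 1) ≤ C / k) ∧ (∃ C' : ℝ, C' < 2 ∧ ∀ k : ℕ, 2 ≤ k →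
Literature.Computability.AlgebraicComplexity.omegaRect ℂ 1 k 1 - (k + 1) ≤ C' *
(Literature.Computability.AlgebraicComplexity.omegaRect ℂ 1 (2 * k) 1 - (2 * k + 1))) ∧
((Literature.Computability.AlgebraicComplexity.omega ℂ - 2) ^ 2 ≤
Literature.Computability.AlgebraicComplexity.omegaRect ℂ 1 2 1 - 3)`

## Assembly
Shifted octave budget: with a_j := e(2^{j+1}), LinearExcessDecay gives a_j ≤ (C/2)·2^{−j} and
TailSubcriticalDoubling (k = 2^{j+1} ≥ 2) gives a_j ≤ C'·a_{j+1}; if C' ≥ 0, a_0 ≤ C'^j a_j ≤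
(C/2)(C'/2)^j → 0 (`exists_pow_lt_of_lt_one`), if C' < 0 then a_0 ≤ C'·a_1 ≤ 0 at once (information
bound `add_one_le_omegaRect_one_mid_one`). So e(2) = a_0 = 0, i.e. ω(1,2,1) = 3, and SquareLink
gives (ω − 2)² ≤ 0, ω = 2 (`MatrixMultiplication_iff`). Conversely ω = 2 makes every e(k) = 0 (k ≥
1), whence all three pieces (C = C' = 0). The deciding theorem `closes` (glue.lean, 75 lines, tree
lemmas only) consumes exactly the three cruxes; SubcriticalDoubling (gen 2) and the five rungs are
ASIDES.

Rationale: WHY THIS LINE. Gen 2 (rev 0) asked the octave cap e(k) ≤ C'·e(2k), C' < 2, at EVERY k ≥ 1, so the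
bridge un-amortised all the way to the square and its
k = 1 slice was the strict exchange inequality ω − 2 ≤ C'(ω(1,2,1) − 3). Gen 3 stops the
un-amortisation at the 1×2 rectangle: RATE (e(k) ≤ C/k) and the
TAIL cap (k ≥ 2) give exactly ω(1,2,1) = 3 (kernel `twoSaturation_iff_led_and_tsd`; the shifted
budget e(2) ≤ C'^{j−1} e(2^j) ≤ (C/2)(C'/2)^{j−1} → 0,
LottiRomani1983 §2 monotonicity `omegaRect_one_mid_one_le_add`, information bound Blaser2013 Lemma
7.1), and the last octave is closed by a different
mechanism — the SQUARE LINK (ω − 2)² ≤ ω(1,2,1) − 3, a square-root modulus of continuity of the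
excess at k = 1 (lens 2's item; HuangPan1998 §8 / the
log-convexity heuristic e(1)² ≤ e(0)e(2)). What it does that gen 2 and the siblings do not: (i) the
complement of the attack piece is now TWO
independently-motivated laws, each STRICTLY WEAKER than gen 2's SubcriticalDoubling (kernel: SD ⟺
TSD ∧ StrictSquareCap, StrictSquareCap ⟹ SquareLink via
the kernel record ω − 2 ≤ 0.37295 < 1/2; not conversely: ω = 2.3, e(2) = 0.09 satisfies the link
with equality and violates strict LIN₂), so the residual
shrank round over round; (ii) the internal node E₂ = TwoSaturation is typed and exact on both sides
(S ⟺ E₂ ∧ SquareLink; E₂ ⟺ RATE ∧ TAIL-CAP), making it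
an OR-node of the cell's tree shared with FarEdgeDescent (there E₂ ⟸ FiniteSaturation ∧
ExcessLogConvexity) — two routes into the classical intermediate
target ω(2) = 3, one square piece out; (iii) the un-amortisation ladder a_i = 0 ⟺ RATE ∧
TailCap_{≥i} (kernel `dyadicSaturation_iff`, every i) exhibits
the whole family of exact nodes of which gen 2 is i = 0 and gen 3 is i = 1, and the truncated budget
(kernel `excessTwo_le_of_caps_of_rung`) says where the
finite range starts to pay: caps C' = 3/2 on 2→4→…→2^J plus the linear rung at K = 2^J give e(2) ≤
(3/4)^{J−1}, below the printed 0.250035 first at K = 64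
(0.2373; K = 32 gives 0.316). The import is the same dyadic (Δ₂-weight) bookkeeping as gen 2 — a
weight with decay k^{−1} and doubling constant C' < 2 sums
to zero — now started at the first octave instead of the origin, plus a Hölder-type link at the
origin. Truth table fully DISTRIBUTED over explicit ω > 2
model profiles (convex, non-increasing, consistent with every kernel and printed constraint):
harmonic e = 0.37/k: (RATE ✓, TAIL ✗ ratio exactly 2, LINK ✓
0.137 ≤ 0.185); record-apparent e = 0.37·k^{−0.57}: (✗, ✓ C' = 1.49, ✓); kink-at-two world ω = 2.3,
e(k) = 0 for k ≥ 2 (= E₂ ∧ ¬S, forced shape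
since RATE ∧ TAIL ⟺ E₂): (✓, ✓, ✗ 0.09 > 0) — so no piece is decided by the others or by S, and ¬S
is LOCATED (`not_summit_iff3`): the rate fails, or un-amortisation down to k = 2 is
critical somewhere, or ω(1,2,1) = 3 holds and the square is not root-linked. TailSubcriticalDoubling
is logically INDEPENDENT of lens 2's OctaveFlatness
(∀λ > 1 eventually; constant-ratio-1.49 world: TSD ✓ OF ✗; one expensive early octave then ratios →
1: OF ✓ TSD ✗). Negatives index (12) has nothing on
the excess profile; ModuleRankGrowth (refuted by perfect amortisation) is the opposite bet and is
respected.

RANKED CRUXES. #2 LinearExcessDecay (crux, unchanged, stmt-25355) — RATE: ∃C ∀k ≥ 1, ω(1,k,1) ≤ k +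
1 + C/k. Tag WEAKER (S ⟹ P kernel, C = 0; FiniteSaturation ⟹ P; P ⟹ PowerAmortisation of
FarEdgeDescent, critic probe); leaf ATTACKABLE-VIA-RUNGS with currency (critic C1/w1): K ≤ 5 KERNEL
(`linearDecayUpTo_two_five`), K ≤ 10 NAMED-FACT-NOW (printed VXXZ-2024 row κ = 3: e(3) ≤ 0.198809 ≤
2/10, kernel `linearDecayUpTo_two_ten_of_table`; K₀^print = 10 because every printed laser table —
LG12 Table 1, LU18 Table 3, VXXZ24 / ADVXXZ25 Table 1 — stops at κ = 3), K = 12 FIRST BEYOND-PRINT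
(kernel `linearDecayUpTo_two_twelve_of_bound`: one bound e(κ₀) ≤ 1/6 at some κ₀ ≤ 11; K = 16 from
e(κ₀) ≤ 1/8; a single fourth-power CW_5 run at κ = 8 plausibly gives both: extrapolated ê(4) ≈
0.168, ê(8) ≈ 0.11), K = ∞ IDEA-NEEDED (no analysis beats Θ(1/log k); CW_q floor ≈ 0.055·k^{−1.48},
census I1, so the class is NOT barred). [open-problem] #3 TailSubcriticalDoubling (crux, NEW) —
TAIL-BRIDGE: ∃C' < 2 ∀k ≥ 2, e(k) ≤ C'·e(2k). Tag WEAKER (S ⟹ P, C' = 0; SD ⟹ P); carries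
RESIDUAL(RATE → E₂) exactly and propagates any finite rung down to E₂ (= lens 2's
DownwardPropagation); leaf INSTRUMENTABLE (octave ratios at k ≥ 2: NOT in print — tables stop at κ =
3, census I3; first-power CW world 1.218, 1.219, 1.200, 1.177, 1.155 → 1; floor ENVELOPE 2.96; ask:
fourth-power CW_5 at κ = 4, 8, 16) → IDEA-NEEDED (an un-blocking inequality losing < ×2 of excess).
[XL] #4 SquareLink (crux, = FarEdgeDescent stmt-23740) — LINK: (ω − 2)² ≤ ω(1,2,1) − 3. Tag WEAKER
(S ⟹ P; records 0.1379 ≤ 0.2500; every computed method world passes, census I5); carries RESIDUAL(E₂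
→ S); leaf UNDECIDED-with-test (T3 done: ✓) + IDEA-NEEDED. [L] #9 asides: SubcriticalDoubling (gen
2's bridge = i = 0 rung of the un-amortisation ladder, banked), LinearDecayTwoUpToFive (kernel),
LinearDecayTwoUpToEight and LinearDecayTwoUpToTen (NAMED-FACT-NOW modulo `vxxz2024_omegaRect_table`;
unconditional once the κ = 3 certificate is vendored), LinearDecayTwoUpToTwelve (FIRST BEYOND-PRINT,
compute), LinearDecayTwoUpToSixteen (compute).

TWO-LAYER PLAN. The node is already two layers semantically (S ⟸ E₂ ∧ SquareLink; E₂ ⟸ RATE ∧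
TAIL-CAP, both exact) but filed flat (closes consumes the three
leaves) because E₂ is an OR-node shared with FarEdgeDescent, not a crux of this route; a later
`--split` is foreseen only for TailSubcriticalDoubling
(dyadic-only form ∀j ≥ 1, a_j ≤ C' a_{j+1}, weaker and sufficient — kernel
`dyadicTailCap_one_of_tsd` — versus all integers k ≥ 2) if a prover wants it.

KILL CRITERIA. "∀C' < 2 ∃k ≥ 2, e(k) > C'·e(2k)" (needs a LOWER bound ω(1,k,1) > k + 1 at a finite k
≥ 4, none known short of ω(1,2,1) > 3) closes the route
refuted:TailSubcriticalDoubling; "∀C ∃k, e(k) > C/k" closes it refuted:LinearExcessDecay (and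
refutes FiniteSaturation / PowerAmortisation δ ≥ 1 with it);
"(ω − 2)² > ω(1,2,1) − 3" refutes SquareLink here AND in FarEdgeDescent (shared item) and implies ω
> 2. A proof of E₂ (ω(1,2,1) = 3, e.g. via
CubicExchangeSplit-type exchange) proves RATE and TAIL outright (kernel
`twoSaturation_iff_led_and_tsd`) and contracts the route to SquareLink; a proof of any
finite rung E_k contracts RATE to a theorem (kernel `linearExcessDecay_of_finiteRung`).

NOT DECOMPOSED YET. The value of C (∃; the ladder uses C = 2); the un-amortisation mechanism behind
the tail cap; real (non-integer) shapes; the other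
ladder members i ≥ 2 (E₄ = ω(1,4,1) = 5 ⟺ RATE ∧ TailCap_{≥2}, each needing its own link E_{2^i} → S
— only i = 1 has a natural link); the dial θ ≠ 1/2 of
gen 2 (kernel `summit_iff_dial`, unchanged); the exponent 2 in the link (lens 2's window lemma: any
p > 1 with constant 1 is a genuine piece, p = 1 is blocking).

CHEAPEST FALSIFIER. Lookup (done): the link at the records, 0.371339² = 0.1379 ≤ 0.250035 ✓; the
tail cap at the only printed tail octave pair (κ, 2κ) =
(1.5, 3): ê(1.5)/ê(3) = 0.2946/0.1988 = 1.48 < 2 ✓ (VXXZ 2024; upper bounds both, consistency not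
truth). The cheapest COMPUTATION that moves a tag: ONE
fourth-power CW_5 laser optimisation at κ = 8 (census menu I2′, ≈ 40 core-h; kit not allowed on this
seat): ê(8) ≤ 0.125 certifies the rungs K = 12 and
K = 16 at once (kernel reductions `linearDecayUpTo_two_twelve_of_bound` / `_sixteen_of_bound`) and
gives the first beyond-print octave ratios ê(2)/ê(4),
ê(4)/ê(8) for the tail cap (prediction from the printed ratio 1.485: ê(4) ≈ 0.168, ê(8) ≈ 0.113).

NUMBERS. ω ≤ 2.371339 (ADVXXZ 2025; kernel 2.37295); ω(1,2,1) ≤ 3.250035, ω(1,1.5,1) ≤ 2.794633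
(ADVXXZ 2025), ω(1,3,1) ≤ 4.198809 (VXXZ 2024, the LAST
printed κ); k·ê(k) = 0.371, 0.500, 0.596 at k = 1, 2, 3; printed octave ratios 1.485 (1→2), 1.48
(1.5→3); first-power CW_q excess 0.4036, 0.3398, 0.2790,
0.2290, 0.1908, 0.1620, 0.1402 at k = 1, 2, 4, 8, 16, 32, 64 (census I2 = lens hand values), reach
of e ≤ 2/k exactly k ≤ 8; CLLZ CW_q floor excess 0.0551
(k = 2), 0.0186 (4), 0.0065 (8), 0.0023 (16), 0.00033 (64) ≈ k^{−1.48} (census I1: RATE unbarred,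
k·floor 0.110 → 0.021); floor-envelope octave ratio 2.96
(2→4) … 2.61 (32→64); truncated budget with C' = 3/2: e(2) ≤ 0.75, 0.56, 0.42, 0.32, 0.237 at K = 4,
8, 16, 32, 64 (record 0.2500 beaten first at K = 64).

DEFINITION REQUESTS. None.

Novelty: Searches (2026-08-30, gen 3): rg over the sub's Theses/*.lean for `2 \* k|2 ≤ k →|\^ 2 ≤|omegaRect ℂ
1 2 1 - 3` (hits: FarEdgeDescent.SquareLink stmt-23740 — ADOPTED as the shared link item, not
re-filed; TallFlatOnset.ExcessDoubling (∃M, no budget) and my gen-2 SubcriticalDoubling (k ≥ 1) —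
the tail form k ≥ 2 is new; FarEdgeDescent.OctaveFlatness stmt-25348 (∀λ > 1 eventually) — logically
independent of TailSubcriticalDoubling, two separating worlds in the rationale); cell TREE.md v8,
CRITIC-LEDGER (C1 on rev 0: w1 currency, w2, w3 answered here), COSTUME-CENSUS v2 rows
D5c/D5d/I1/I2/I3/I5; `ledger negatives --problem MatrixMultiplication` (12, none on the excess
profile); lit search --hybrid "rectangular matrix multiplication exponent omega(1,1,k) rate of
convergence to k+1 doubling k 2k" -n 8 ([corpus:book:burgisser1997-algebraic-complexity-theory
p.410–413] the limit and the rectangular-to-square transfer R(⟨e,h,l⟩) only;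
[corpus:book:landsberg2017-geometry-complexity-theory p.13–14, 68] definitions/records;
[corpus:book:hsieh2023-combinatorial-algorithms p.228–230] uses of ω(a,b,c) in clique detection — no
rate or octave law); lit vsearch of TailSubcriticalDoubling in prose -k 8 (same books, no
statement-level hit); lit galaxy search --star all "omega(1,1,2k)|ω(1,1,2k)|w(1,1,2k)|omega(2k)" (10
rows, all substring noise: solitons/ocean waves), "ω(2) = 3|omega(2)=3|omega(1,2,1)|ω(1,2,1)" (4
rows: LNCS front matter, noise), "rate of convergence of ω(1,1,k)|convergence of o  [refs: book:burgisser1997-algebraic-complexity-theory, book:landsberg2017-geometry-complexity-theory, book:hsieh2023-combinatorial-algorithms, arxiv-1708.05622, LottiRomani1983, LeGall2012, HuangPan1998, Coppersmith1982, ChristandlLeGallLysikovZuiddam2025]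

Barriers (technique_class: rectangular-exponents, laser-method, self-similarity): - technique_class: rectangular-exponents, laser-method, self-similarity
- Literature.Barriers.MatrixMultiplication.RectangularBarrier: LinearExcessDecay sits INSIDE the
laser/CW_q class by design and the barrier does not exclude it: CLLZ Thm 3.15/§4.4 bars ω̂(1,1,k) =
k+1 at each finite k for CW_q (kernel `CLLZ2025_omegaTwo_barrier_CW_holds` at k = 2), but the floor
excess b_q(k) − (k+1) decays faster than C/k in k (expansion of the §4.4 support functional at θ =
(0,½,½): slope 2 in θ₁ against an entropy gain ~θ₁ log(1/θ₁), floor excess ~1/(k log² k)) and q may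
grow with k; the rungs k ≤ 9 are certified by CW_q itself. TailSubcriticalDoubling (k ≥ 2) and
SquareLink are inequalities BETWEEN exponents at two shapes (k vs 2k; the square vs the 1×2
rectangle) — outside the class (they certify no single exponent); CLLZ floors (census I1: CW_1 floor
excess 0.0551 at k = 2, ≈ k^{−1.48}; floor-ENVELOPE octave ratio 2.96 at 2→4) are lower bounds on
what the CW_q method can certify, not on true exponents, so they neither bar nor support the two
relational pieces; SquareLink passes every computed method world (census I5, slack ≈ e(2)/2 inside
the live window e(2) < 1/9).
- Literature.Barriers.MatrixMultiplication.UniversalMethodBarrier: stated for ω from a fixed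
starting tensor; LinearExcessDecay with q growing in k uses no fixed tensor (outside); at fixed q it
is a rate statement the barrier does not quantify over; TailSubcriticalDoubling and SquareLink
outside (no starting tensor; rel

History (route lifecycle, newest last):
- 2026-08-30T03:11:01Z · rev 3: restated Assembly (stmt-MatrixMultiplication-25360) — gen 3: Assembly restated to match the re-glued closes (LED → TSD → SquareLink → S); the gen-2 assembly LED → SD → S remains a kernel theorem (closes_of_closes3 (planner-decomp-mm-lens-5-g3-0)
- 2026-08-30T03:11:31Z · rev 4: informal re-worded for LinearDecayTwoUpToEight (planner-decomp-mm-lens-5-g3-0)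
- 2026-08-30T08:14:32Z · rev 7: dropped LinearDecayTenOfPrintedTable — decomp-mm lens-5 g10: (i) staffability fix — drop aside LinearDecayTenOfPrintedTable (26574; hypothesis = cite-only def vxxz2024_omegaRect_table, the route's on (planner-decomp-mm-lens-5-g10-0)
- 2026-09-04T15:42:28Z · DORMANT — reconciler: no traction for 5 d (last activity statement-checked at 2026-08-30T14:26:42Z); parked, not closed — `ledger route dormant route-MatrixMultiplication (operator:999:3284266)

sub-problem: MatrixMultiplication · status: dormant · opened planner-decomp-mm-lens-5-g2-0 2026-08-30T02:32:39Z · rev 8 · ledger route-MatrixMultiplication-OctaveBudget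
GENERATED by the gate from the ledger (D-0016/17). Provers cite these decls: `theorem foo : Summit.MatrixMultiplication.MatrixMultiplication.Theses.OctaveBudget.<Decl> := …` in Summits/MatrixMultiplication/MatrixMultiplication/Theorems/<Name>.lean.
-/

namespace Summit.MatrixMultiplication.MatrixMultiplication.Theses.OctaveBudget

open scoped BigOperators Topology Manifold Classical MeasureTheory ProbabilityTheory Matrix InnerProductSpace ComplexConjugate ContinuousMap
open Filter Set Function TopologicalSpace MeasureTheory

attribute [summit_statement] _root_.MatrixMultiplication

/-- item stmt-MatrixMultiplication-25355 · crux · rank 2 · open · by planner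
why it might fail: every known analysis amortises at rate Θ(1/log k) (Lotti–Romani Prop 4.1, first-power CW_q: 0.69/ln k); if ω > 2 the true profile may be logarithmic, e.g. e(k) ~ (ω−2)/log₂(2k), and then no C works.
sources: LottiRomani1983, Coppersmith1982, HuangPan1998, ChristandlLeGallLysikovZuiddam2025, LeGallUrrutia2018
[crux] RATE — linear excess decay along the long-shape axis: there is a constant C with ω(1,k,1) ≤ k
+ 1 + C/k for every integer k ≥ 1 (K^{k−1} simultaneous K×K products cost K^{2+O(1/k)} each). Tag
WEAKER (S ⟹ P kernel `linearExcessDecay_of_summit`, C = 0; P holds for e = 0.37/k with ω = 2.37;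
FiniteSaturation ⟹ P kernel `linearExcessDecay_of_finiteRung`); leaf ATTACKABLE-VIA-RUNGS (asides
LinearDecayTwoUpToFive kernel-proved `linearDecayUpTo_two_five`; LinearDecayTwoUpToEight
ATTACKABLE-NOW from the kernel first-power CW_q rate `omegaRect_le_of_packing` at (k,q) =
(6,19),(7,22),(8,24): e ≤ 0.2483, 0.2377, 0.2290 ≤ 2/k; LinearDecayTwoUpToSixteen
COMPUTE-INSTRUMENTABLE: needs e(16) ≤ 0.125, first power gives 0.1908) → IDEA-NEEDED for K = ∞ (no
analysis in print beats Θ(1/log k); census instrument I2′: optimised CW_q^{⊗2,4} tall profile k =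
4…64, apparent exponent). [difficulty: open-problem] -/
@[route_item "route-MatrixMultiplication-OctaveBudget"]
def LinearExcessDecay : Prop :=
  ∃ C : ℝ, ∀ k : ℕ, 1 ≤ k → Literature.Computability.AlgebraicComplexity.omegaRect ℂ 1 k 1 - (k + 1) ≤ C / k

/-- item stmt-MatrixMultiplication-26289 · crux · rank 3 · open · by planner
why it might fail: ω(1,2,1) > 3 with a tail decaying like 1/k or faster from k = 2 on (e(k) ~ k^(−1.2) along the dyadics has octave ratio 2.3 > 2 in every tail); if true profiles hug the CLLZ floor envelope (ratio 2.96 at 2→4, census I3) no C′ < 2 works.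
sources: LottiRomani1983, VassilevskaWilliamsXuXuZhou2024, ChristandlLeGallLysikovZuiddam2025, Coppersmith1982
[crux · gen 3 (N5″) · TAIL-BRIDGE with budget · tag WEAKER (S ⟹ it with C′ = 0, kernel
`tailSubcriticalDoubling_of_summit` in the lens draft HOME/decomp-mm-lens-5/OctaveBudget_v3.lean;
than SubcriticalDoubling: SD ⟺ this ∧ StrictSquareCap, kernel `sd_iff_tsd_and_ssc` — the k = 1
slice, strict LIN₂ at the square, is dropped) · NOT the bare residual: it carries the residual of
LinearExcessDecay only down to the 1×2 rectangle — TwoSaturation (ω(1,2,1) = 3) ⟺ LinearExcessDecay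
∧ this exactly, kernel `twoSaturation_iff_led_and_tsd` (shifted budget e(2) ≤ C′^{j−1} e(2^j) ≤
(C/2)(C′/2)^{j−1} → 0) — and propagates ANY finite rung ω(1,k₀,1) = k₀+1 down to ω(1,2,1) = 3
(`twoSaturation_of_finiteRung_of_tsd`, = lens 2's DownwardPropagation) · INDEPENDENT of lens 2's
OctaveFlatness (stmt-25348, ∀λ > 1 eventually): constant-ratio world e = A·k^(−0.58) (ratio 1.49 at
every k): this ✓, OF ✗; one expensive early octave (ratio 2.5 at k = 2, ratios → 1 after): OF ✓,
this ✗ · leaf INSTRUMENTABLE (octave ratios ê(k)/ê(2k) of method profiles at k ≥ 2: record tables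
stop at κ = 3 so ê(2)/ê(4) is NOT in print — census v2 I3 —, printed tail pair (1.5, 3):
0.2946/0.1988 = 1.48; first-power CW_q world 1.218 -/
@[route_item "route-MatrixMultiplication-OctaveBudget"]
def TailSubcriticalDoubling : Prop :=
  ∃ C' : ℝ, C' < 2 ∧ ∀ k : ℕ, 2 ≤ k → Literature.Computability.AlgebraicComplexity.omegaRect ℂ 1 k 1 - (k + 1) ≤ C' * (Literature.Computability.AlgebraicComplexity.omegaRect ℂ 1 (2 * k) 1 - (2 * k + 1))

/-- item stmt-MatrixMultiplication-23740 · crux · rank 4 · open · by planner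
why it might fail: ω(1,2,1) may sit much closer to 3 than ω to 2 (e(2) < (ω−2)², e.g. ω = 2.3 with ω(1,2,1) < 3.09); nothing known correlates the two deficits beyond monotonicity e(2) ≤ e(1) and convexity of the excess.
sources: AlmanDuanVassilevskaWilliamsXuXuZhou2025, VassilevskaWilliamsXuXuZhou2024, HuangPan1998, LottiRomani1983
[crux] the SQUARE link — (ω − 2)² ≤ ω(1,2,1) − 3, i.e. e(1)² ≤ e(0)·e(2) with e(0) = ω(1,0,1) − 1 =
1: a modulus of continuity ω − 2 ≤ √e(2) for square closure (blocking gives only ω − 2 ≤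
(1+3e(2))/4). Tag WEAKER (S ⟹ P kernel `squareLink_of_mm`; P holds at the record values 0.371339² =
0.1379 ≤ 0.250035 and in the one-dark-vertex model, e(2) = 0.1618); leaf UNDECIDED-with-test (T3: in
each self-consistent method world is (ω̂−2)² ≤ ω̂(1,2,1) − 3? CLLZ world 0.028 ≤ 0.0626 ✓) +
IDEA-NEEDED. [difficulty: L] -/
@[route_item "route-MatrixMultiplication-OctaveBudget"]
def SquareLink : Prop :=
  (Literature.Computability.AlgebraicComplexity.omega ℂ - 2) ^ 2 ≤ Literature.Computability.AlgebraicComplexity.omegaRect ℂ 1 2 1 - 3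

/-- item stmt-MatrixMultiplication-25356 · aside · rank 3 · open · by planner
why it might fail: if ω > 2 with excess decaying at rate 1/k or faster along some dyadics (harmonic profile: octave ratio exactly 2; a kink at a finite k₀: ratio ∞) the budget 2 is violated; no technique converts ⟨n,n,n^{2k}⟩-algorithms into ⟨n,n,n^k⟩-algorithms beyond blocking.
sources: LottiRomani1983, AlmanDuanVassilevskaWilliamsXuXuZhou2025, VassilevskaWilliamsXuXuZhou2024, Coppersmith1982
[crux] BRIDGE with budget — subcritical doubling law for the long-shape excess: there is a constant
C' < 2 with ω(1,k,1) − (k+1) ≤ C'·(ω(1,2k,1) − (2k+1)) for every integer k ≥ 1 (halving the long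
dimension of ⟨n, n^{2k}, n⟩ costs less than twice the excess). Tag WEAKER (S ⟹ P kernel
`subcriticalDoubling_of_summit`, C' = 0; P holds for e = 0.37·k^{−0.57} with ω = 2.37) and STRONGER
than gen-0's ExcessDoubling (kernel `doubling_of_subcriticalDoubling`; carries the residuals
`onsetRigidity_of_subcriticalDoubling`, `summit_of_linearExcessDecay_of_subcriticalDoubling`); k = 1
slice = STRICT LIN₂ ω − 2 ≤ C'(ω(1,2,1) − 3), C' < 2 (kernel `strictLinTwo_of_subcriticalDoubling`;
records 0.371339 ≤ 1.49·0.250035); leaf INSTRUMENTABLE (I3: octave ratios — record profile 1.485,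
1.484; kernel CW_q profile 1.19, 1.22, 1.22, 1.20, 1.18, 1.14 at k = 1, 2, 4, 8, 16, 64, → 1; all <
2) → IDEA-NEEDED (an un-amortisation mechanism; blocking gives only e(2k) ≤ e(k)). [difficulty: XL] -/
@[route_item "route-MatrixMultiplication-OctaveBudget"]
def SubcriticalDoubling : Prop :=
  ∃ C' : ℝ, C' < 2 ∧ ∀ k : ℕ, 1 ≤ k → Literature.Computability.AlgebraicComplexity.omegaRect ℂ 1 k 1 - (k + 1) ≤ C' * (Literature.Computability.AlgebraicComplexity.omegaRect ℂ 1 (2 * k) 1 - (2 * k + 1))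

/-- item stmt-MatrixMultiplication-24159 · aside · rank 9 · open · by planner
[crux] BRIDGE — doubling law for the long-shape excess: there is a constant C with ω(1,k,1) − (k+1)
≤ C·(ω(1,2k,1) − (2k+1)) for every integer k ≥ 1 (halving the long dimension of ⟨n, n^{2k}, n⟩ costs
at most a constant factor of excess; forbids a kink of k ↦ ω(1,k,1) at a finite k₀ > 1 and
super-polynomial decay of the excess along the dyadics). Tag WEAKER (S ⟹ P kernel
`excessDoubling_of_summit`, C = 0; P holds for e(k) = 0.3k^{−0.6} with ω = 2.3); leaf INSTRUMENTABLE
(I3: doubling constant of the record profile ê(1)/ê(2) = 0.371552/0.250385 = 1.484, ê(1.5)/ê(3) =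
0.294941/0.198809 = 1.484; of the kernel CW_q profile ≤ 1.222, → 1) → IDEA-NEEDED (an
un-amortisation mechanism; blocking gives only e(2k) ≤ e(k)). [difficulty: XL] -/
@[route_item "route-MatrixMultiplication-OctaveBudget"]
def ExcessDoubling : Prop :=
  ∃ C : ℝ, ∀ k : ℕ, 1 ≤ k → Literature.Computability.AlgebraicComplexity.omegaRect ℂ 1 k 1 - (k + 1) ≤ C * (Literature.Computability.AlgebraicComplexity.omegaRect ℂ 1 (2 * k) 1 - (2 * k + 1))

/-- item stmt-MatrixMultiplication-25357 · aside · rank 9 · closed · proved by Summit.MatrixMultiplication.MatrixMultiplication.Theorems.OctaveBudgetLinearDecayTwoUpToFive.linearDecayTwoUpToFive_holds (planner) · by planner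
sources: LeGall2014, LottiRomani1983
[support] RUNG (kernel-proved in the lens draft, `linearDecayUpTo_two_five`; BC5 witness of
LinearExcessDecay): ω(1,k,1) ≤ k + 1 + 2/k for the integers 1 ≤ k ≤ 5 (from ω ≤ 2.37295 and
monotonicity of the excess). [difficulty: provable-now] -/
@[route_item "route-MatrixMultiplication-OctaveBudget"]
def LinearDecayTwoUpToFive : Prop :=
  ∀ k : ℕ, 1 ≤ k → k ≤ 5 → Literature.Computability.AlgebraicComplexity.omegaRect ℂ 1 k 1 - (k + 1) ≤ 2 / k

-- `LinearDecayTwoUpToFive` holds: proved by `Summit.MatrixMultiplication.MatrixMultiplication.Theorems.OctaveBudgetLinearDecayTwoUpToFive.linearDecayTwoUpToFive_holds` (its module imports this route file, so no `_holds` link can be stated here).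

/-- item stmt-MatrixMultiplication-25358 · aside · rank 9 · closed · proved by Summit.MatrixMultiplication.MatrixMultiplication.Theorems.OctaveBudgetKernelFamily.linearDecayTwoUpToEight_holds (planner) · by planner
sources: HuangPan1998, CoppersmithWinograd1990, LottiRomani1983
[aside · RUNG K = 8 of LinearExcessDecay's finite range · NAMED-FACT-NOW (critic C1/w1 currency,
superseding gen 2's "ATTACKABLE-NOW via first-power CW_q"): k ≤ 5 kernel
(`linearDecayUpTo_two_five`, from ω ≤ 2.37295); 6 ≤ k ≤ 8 from the PRINTED VXXZ-2024 Table 1 row κ =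
3 (ω(1,3,1) ≤ 4.198809, so e(k) ≤ e(3) ≤ 0.198809 ≤ 2/8 by monotonicity of the excess), kernel
`linearDecayTwoUpToEight_of_table (hT : vxxz2024_omegaRect_table)` in the critic's probe
HOME/critic/L5_OctaveBudget_v1_probe.lean and `linearDecayUpTo_two_ten_of_table` in the lens draft
(the same row reaches K = 10, stmt-MatrixMultiplication-26290); the first-power CW_q kernel route
(`omegaRect_le_of_packing` at (k,q) = (6,19),(7,22),(8,24): e ≤ 0.2483, 0.2377, 0.2290) remains the
table-free alternative] ω(1,k,1) ≤ k + 1 + 2/k for the integers 1 ≤ k ≤ 8. -/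
@[route_item "route-MatrixMultiplication-OctaveBudget"]
def LinearDecayTwoUpToEight : Prop :=
  ∀ k : ℕ, 1 ≤ k → k ≤ 8 → Literature.Computability.AlgebraicComplexity.omegaRect ℂ 1 k 1 - (k + 1) ≤ 2 / k

-- `LinearDecayTwoUpToEight` holds: proved by `Summit.MatrixMultiplication.MatrixMultiplication.Theorems.OctaveBudgetKernelFamily.linearDecayTwoUpToEight_holds` (its module imports this route file, so no `_holds` link can be stated here).

/-- item stmt-MatrixMultiplication-25359 · aside · rank 9 · closed · proved by Summit.MatrixMultiplication.MatrixMultiplication.Theorems.OctaveBudgetFivePattern.linearDecayTwoUpToSixteen_holds (planner) · by planner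
sources: LeGallUrrutia2018, VassilevskaWilliamsXuXuZhou2024, LottiRomani1983
[support] RUNG (COMPUTE-INSTRUMENTABLE → certificate; measures how far the finite range reaches
inside the laser class): ω(1,k,1) ≤ k + 1 + 2/k for the integers 1 ≤ k ≤ 16 — needs e(16) ≤ 0.125
(first-power CW_q gives 0.1908; higher CW powers / VXXZ-type analyses at k = 16 are not in print:
census instrument I2′). [difficulty: L] -/
@[route_item "route-MatrixMultiplication-OctaveBudget"]
def LinearDecayTwoUpToSixteen : Prop :=
  ∀ k : ℕ, 1 ≤ k → k ≤ 16 → Literature.Computability.AlgebraicComplexity.omegaRect ℂ 1 k 1 - (k + 1) ≤ 2 / k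

-- `LinearDecayTwoUpToSixteen` holds: proved by `Summit.MatrixMultiplication.MatrixMultiplication.Theorems.OctaveBudgetFivePattern.linearDecayTwoUpToSixteen_holds` (its module imports this route file, so no `_holds` link can be stated here).

/-- item stmt-MatrixMultiplication-26290 · aside · rank 9 · closed · proved by Summit.MatrixMultiplication.MatrixMultiplication.Theorems.OctaveBudgetFivePattern.linearDecayTwoUpToTen_holds (planner) · by planner
why it might fail: it cannot modulo the table: provable now from the named fact vxxz2024_omegaRect_table (row κ = 3); an unconditional kernel proof needs the κ = 3 certificate of VXXZ 2024 §8 (the tree's RectangularExponentCert is κ = 1 only) — filed as the currency marker K₀^print = 10.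
sources: VassilevskaWilliamsXuXuZhou2024, LeGallUrrutia2018, LeGall2012
[aside · RUNG K = 10 of LinearExcessDecay's finite range · NAMED-FACT-NOW (critic C1/w1 currency) ·
kernel for k ≤ 5 (`linearDecayUpTo_two_five`, from ω ≤ 2.37295) and for 6 ≤ k ≤ 10 from the PRINTED
VXXZ-2024 Table 1 row κ = 3 (ω(1,3,1) ≤ 4.198809: e(k) ≤ e(3) ≤ 0.198809 ≤ 2/10), kernel
`linearDecayUpTo_two_ten_of_table (hT : vxxz2024_omegaRect_table)` in the lens draft
OctaveBudget_v3.lean (= the critic's probe `linearDecayTwoUpToTen_of_table`,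
HOME/critic/L5_OctaveBudget_v1_probe.lean) · K₀^print = 10: the printed laser tables (Le Gall 2012
Table 1, Le Gall–Urrutia 2018 Table 3, VXXZ 2024 / ADVXXZ 2025 Table 1) all stop at κ = 3
([corpus:arxiv-1708.05622 p4] «ω(3) ≤ 4.199712»; tree `vxxz2024Table` last row (3.00, 4.198809)), so
every rung K ≥ 11 needs a beyond-print κ-bound] ω(1,k,1) ≤ k + 1 + 2/k for the integers 1 ≤ k ≤ 10. -/
@[route_item "route-MatrixMultiplication-OctaveBudget"]
def LinearDecayTwoUpToTen : Prop :=
  ∀ k : ℕ, 1 ≤ k → k ≤ 10 → Literature.Computability.AlgebraicComplexity.omegaRect ℂ 1 k 1 - (k + 1) ≤ 2 / k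

-- `LinearDecayTwoUpToTen` holds: proved by `Summit.MatrixMultiplication.MatrixMultiplication.Theorems.OctaveBudgetFivePattern.linearDecayTwoUpToTen_holds` (its module imports this route file, so no `_holds` link can be stated here).

/-- item stmt-MatrixMultiplication-26291 · aside · rank 9 · closed · proved by Summit.MatrixMultiplication.MatrixMultiplication.Theorems.OctaveBudgetFivePattern.linearDecayTwoUpToTwelve_holds (planner) · by planner
why it might fail: the re-optimised fourth-power CW_5 value at κ ∈ [4, 11] may stay above κ + 1 + 1/6 (extrapolated ê(4) ≈ 0.168 vs the needed 0.1667 is marginal; ê(8) ≈ 0.113 has slack): the rung then records the exact reach of the laser class on the linear envelope 2/k.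
sources: VassilevskaWilliamsXuXuZhou2024, LeGallUrrutia2018, ChristandlLeGallLysikovZuiddam2025
[aside · RUNG K = 12 · FIRST BEYOND-PRINT rung of the finite range (COMPUTE-INSTRUMENTABLE) · kernel
`linearDecayUpTo_two_twelve_of_bound` (lens draft) reduces it to the printed row κ = 3 plus ONE new
bound ω(1,κ₀,1) ≤ κ₀ + 1 + 1/6 at any real κ₀ ≤ 11; the sibling rung K = 16 (stmt-25359) reduces
likewise to e(κ₀) ≤ 1/8 (`linearDecayUpTo_two_sixteen_of_bound`) · the first-power CW_q kernel route
reaches only e ≈ 0.21 at k = 11 (census I2: 0.2290 at 8, 0.1908 at 16; reach of e ≤ 2/k is exactly k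
≤ 8), the CLLZ CW_q floor is 0.0035 at k = 12 (census I1: not barred), so ONE fourth-power CW_5
laser optimisation at κ = 8 (census menu I2′, ≈ 40 core-h) plausibly certifies K = 12 and K = 16
together — extrapolating the printed octave ratio 1.485 from ê(2) = 0.2500 predicts ê(4) ≈ 0.168,
ê(8) ≈ 0.113 ≤ 0.125] ω(1,k,1) ≤ k + 1 + 2/k for the integers 1 ≤ k ≤ 12. -/
@[route_item "route-MatrixMultiplication-OctaveBudget"]
def LinearDecayTwoUpToTwelve : Prop :=
  ∀ k : ℕ, 1 ≤ k → k ≤ 12 → Literature.Computability.AlgebraicComplexity.omegaRect ℂ 1 k 1 - (k + 1) ≤ 2 / k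

-- `LinearDecayTwoUpToTwelve` holds: proved by `Summit.MatrixMultiplication.MatrixMultiplication.Theorems.OctaveBudgetFivePattern.linearDecayTwoUpToTwelve_holds` (its module imports this route file, so no `_holds` link can be stated here).

/-- item stmt-MatrixMultiplication-30879 · aside · rank 9 · closed · proved by Summit.MatrixMultiplication.MatrixMultiplication.Theorems.OctaveBudgetLinearDecayTenOfRowThree.linearDecayTenOfRowThree_holds (planner) · by planner
[aside · RUNG K = 10 CONDITIONAL ON ONE PRINTED ROW, hypothesis-explicit · replaces
LinearDecayTenOfPrintedTable (stmt-26574, dropped in this edit: its hypothesis was the cite-only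
named fact `vxxz2024_omegaRect_table`, the one unproved constant that made the route unstaffable —
`route show`: «1 unproved dep … vxxz2024_omegaRect_table [cite_only]») · hypothesis = the κ = 3 row
of VXXZ 2024 Table 1, ω(1,3,1) ≤ 4.198809 (e(3) ≤ 0.198809), conclusion = the rung e(k) ≤ 2/k on 1 ≤
k ≤ 10; PROVABLE-NOW: with the landed rung (2,5)
(`OctaveBudgetLinearDecayTwoUpToFive.rung_two_five`, item 25357 CLOSED) and the antitone excess,
e(k) ≤ 0.198809 ≤ 2/10 on 6 ≤ k ≤ 10 (`rung_of_tail_bound`); landing form ready (decomp-mm lens-5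
g10). Currency unchanged: K₀^print = 10. [difficulty: provable-now] Sources:
VassilevskaWilliamsXuXuZhou2024 Table 1; LeGall2014 Thm 1.1. -/
@[route_item "route-MatrixMultiplication-OctaveBudget"]
def LinearDecayTenOfRowThree : Prop :=
  Literature.Computability.AlgebraicComplexity.omegaRect ℂ 1 3 1 ≤ 4.198809 → ∀ k : ℕ, 1 ≤ k → k ≤ 10 → Literature.Computability.AlgebraicComplexity.omegaRect ℂ 1 k 1 - (k + 1) ≤ 2 / k

-- `LinearDecayTenOfRowThree` holds: proved by `Summit.MatrixMultiplication.MatrixMultiplication.Theorems.OctaveBudgetLinearDecayTenOfRowThree.linearDecayTenOfRowThree_holds` (its module imports this route file, so no `_holds` link can be stated here).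

/-- item stmt-MatrixMultiplication-31706 · aside · rank 9 · closed · proved by Summit.MatrixMultiplication.MatrixMultiplication.Theorems.OctaveBudgetFivePattern.linearDecayTwoUpToTwenty_holds (planner) · by planner
[aside · RUNG K = 20 of LinearExcessDecay's finite range = the CENSUS CEILING K₀ = 20 of all powers
≤ 2 of CW_q (cell census COSTUME-CENSUS-v3 H1′: ê(20) = 0.0989 ≤ 1/10 < …, ê(24) = 0.0932 > 1/12) ·
PROVABLE-NOW and kernel-ready (decomp-mm lens-5 g11): `OctaveBudgetFivePatternCerts.rung_two_twenty`
— table-free, decimal-free, from tree theorems only: the kernel-family rung K = 9 (closed form e(k)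
≤ log 2/log(2k+2) of the first-power CW_{2k+2} pipeline
`PerfectAmortisation.omegaRect_le_of_packing`, plus q = 26 at k = 9) chained by the landed
`rung_of_tail_bound` with five exact full-first-power five-pattern certificates e(10) ≤ 1/7 (CW_16,
type (4,40,1)), e(15) ≤ 1/8 (CW_23), e(17) ≤ 1/9 (CW_25), e(19) ≤ 2/19 (CW_27, type (10,190,3)),
e(20) ≤ 1/10 (CW_27, type (25,500,8); margin 5·10⁻⁵), each decided by `norm_num` on two comparisons
of products of integer powers · lens-5 currency: with this item the FINITE RANGE at C = 2 is
EXHAUSTED IN CLASS and IN KERNEL; k·e₁(k) → ∞ for the first-power family, so no finite range of it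
reaches the crux LinearExcessDecay (K = ∞) — the bridge is TailSubcriticalDoubling; banked context,
never staffed, not progress on the crux. [difficulty: provable- -/
@[route_item "route-MatrixMultiplication-OctaveBudget"]
def LinearDecayTwoUpToTwenty : Prop :=
  ∀ k : ℕ, 1 ≤ k → k ≤ 20 → Literature.Computability.AlgebraicComplexity.omegaRect ℂ 1 k 1 - (k + 1) ≤ 2 / k

-- `LinearDecayTwoUpToTwenty` holds: proved by `Summit.MatrixMultiplication.MatrixMultiplication.Theorems.OctaveBudgetFivePattern.linearDecayTwoUpToTwenty_holds` (its module imports this route file, so no `_holds` link can be stated here).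

-- earlier Assembly (stmt-MatrixMultiplication-25360, replaced 2026-08-30T03:11:01Z -> stmt-MatrixMultiplication-26387): retired by None — LinearExcessDecay → SubcriticalDoubling → _root_.MatrixMultiplication
/-- item stmt-MatrixMultiplication-26387 · assembly · rank 1 · closed · proved by Summit.MatrixMultiplication.MatrixMultiplication.Theorems.OctaveBudgetAssembly.assembly_holds (planner) · by planner
sources: LottiRomani1983, Coppersmith1982, HuangPan1998
[assembly · gen 3] LinearExcessDecay → TailSubcriticalDoubling → SquareLink → ω(ℂ) = 2 (shifted
octave budget to ω(1,2,1) = 3, then the square link; = `closes`). -/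
@[route_item "route-MatrixMultiplication-OctaveBudget"]
def Assembly : Prop :=
  LinearExcessDecay → TailSubcriticalDoubling → SquareLink → _root_.MatrixMultiplication

-- `Assembly` holds: proved by `Summit.MatrixMultiplication.MatrixMultiplication.Theorems.OctaveBudgetAssembly.assembly_holds` (its module imports this route file, so no `_holds` link can be stated here).

/-! D-0027 §2.1 — DECIDING THEOREM (planner-authored via `route open/edit --closes-file`; by planner-decomp-mm-lens-5-g3-0 2026-08-30T03:09:29Z):
its hypotheses are this route's items and its conclusion the sub-problem Statement (glue_lint), and it elaborates with this file. -/

@[closes "route-MatrixMultiplication-OctaveBudget"] theorem closes (h₁ : LinearExcessDecay) (h₂ : TailSubcriticalDoubling) (h₃ : SquareLink) : _root_.MatrixMultiplication := by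
  -- the information bound (floor) along the long-shape axis
  have floor : ∀ p : ℝ, p + 1 ≤ Literature.Computability.AlgebraicComplexity.omegaRect ℂ 1 p 1 :=
    fun p => Literature.Computability.AlgebraicComplexity.add_one_le_omegaRect_one_mid_one ℂ p
  obtain ⟨C, hC⟩ := h₁
  obtain ⟨C', hC'2, hcap⟩ := h₂
  have hL := h₃
  unfold SquareLink at hL
  -- the SHIFTED dyadic excess sequence a j := e(2^(j+1)) = ω(1,2^(j+1),1) − (2^(j+1) + 1)
  obtain ⟨a, ha⟩ : ∃ a : ℕ → ℝ, ∀ j, a j =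
      Literature.Computability.AlgebraicComplexity.omegaRect ℂ 1 ((2 : ℝ) ^ (j + 1)) 1 -
        ((2 : ℝ) ^ (j + 1) + 1) :=
    ⟨fun j => _, fun j => rfl⟩
  have a_nonneg : ∀ j, 0 ≤ a j := fun j => by
    rw [ha]; have := floor ((2 : ℝ) ^ (j + 1)); linarith
  -- RATE at θ = 1/2 from octave 1 on: a j ≤ (C/2) (1/2)^j
  have a_rate : ∀ j, a j ≤ C / 2 * (1 / 2 : ℝ) ^ j := fun j => by
    have h := hC (2 ^ (j + 1)) Nat.one_le_two_pow
    push_cast at h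
    have e : C / (2 : ℝ) ^ (j + 1) = C / 2 * (1 / 2 : ℝ) ^ j := by
      rw [one_div_pow, pow_succ]; ring
    rw [ha, ← e]
    exact h
  -- TAIL CAP at k = 2^(j+1) ≥ 2: a j ≤ C' a (j+1)
  have a_cap : ∀ j, a j ≤ C' * a (j + 1) := fun j => by
    have h2 : 2 ≤ 2 ^ (j + 1) :=
      calc 2 = 2 ^ 1 := by norm_num
        _ ≤ 2 ^ (j + 1) := Nat.pow_le_pow_right (by norm_num) (by omega)
    have h := hcap (2 ^ (j + 1)) h2
    push_cast at h
    rw [← pow_succ'] at h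
    rw [ha, ha]
    exact h
  -- the octave budget from octave 1: a 0 ≤ C'^j a j ≤ (C/2) (C'/2)^j → 0, hence a 0 ≤ 0
  have goal : a 0 ≤ 0 := by
    by_cases hC'0 : 0 ≤ C'
    · have desc : ∀ j, a 0 ≤ C' ^ j * a j := by
        intro j
        induction j with
        | zero => simp
        | succ j ih =>
          calc a 0 ≤ C' ^ j * a j := ih
            _ ≤ C' ^ j * (C' * a (j + 1)) := mul_le_mul_of_nonneg_left (a_cap j) (pow_nonneg hC'0 j)
            _ = C' ^ (j + 1) * a (j + 1) := by ring
      have key : ∀ j, a 0 ≤ C / 2 * (C' * (1 / 2 : ℝ)) ^ j := fun j =>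
        calc a 0 ≤ C' ^ j * a j := desc j
          _ ≤ C' ^ j * (C / 2 * (1 / 2 : ℝ) ^ j) :=
              mul_le_mul_of_nonneg_left (a_rate j) (pow_nonneg hC'0 j)
          _ = C / 2 * (C' * (1 / 2 : ℝ)) ^ j := by rw [mul_pow]; ring
      by_contra hpos
      push Not at hpos
      by_cases hC0 : C / 2 ≤ 0
      · have h := key 0
        simp at h
        linarith
      · push Not at hC0
        have hr : C' * (1 / 2 : ℝ) < 1 := by linarith
        obtain ⟨j, hj⟩ := exists_pow_lt_of_lt_one (div_pos hpos hC0) hr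
        have h := key j
        have h2 : C / 2 * (C' * (1 / 2 : ℝ)) ^ j < C / 2 * (a 0 / (C / 2)) :=
          mul_lt_mul_of_pos_left hj hC0
        rw [mul_div_cancel₀ _ hC0.ne'] at h2
        linarith
    · push Not at hC'0
      have h := a_cap 0
      have h1 := a_nonneg 1
      nlinarith
  -- a 0 = ω(1,2,1) − 3, so ω(1,2,1) = 3 (two-saturation); the square link then gives (ω − 2)² ≤ 0
  have h0 := ha 0
  norm_num at h0
  have e2 : Literature.Computability.AlgebraicComplexity.omegaRect ℂ 1 2 1 - 3 ≤ 0 := by linarith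
  have hsq : (Literature.Computability.AlgebraicComplexity.omega ℂ - 2) ^ 2 = 0 :=
    le_antisymm (hL.trans e2) (sq_nonneg _)
  have hz : Literature.Computability.AlgebraicComplexity.omega ℂ - 2 = 0 :=
    (pow_eq_zero_iff two_ne_zero).1 hsq
  rw [_root_.MatrixMultiplication_iff]
  linarith

end Summit.MatrixMultiplication.MatrixMultiplication.Theses.OctaveBudget
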